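import Literature.NumberTheory.Automorphic.LocalUnitaryGroupNoncompactRankTwo          -- ★ the rank-2 template `not_compactSpace_local_antidiagTwo` (unipotents + trace functional); brings ★ Liu2021 `LemD1OfPlace` (local Gram, module topology), local fields
import Literature.NumberTheory.Rogawski1990.CMLocalAPacketMembers                     -- ★ `Gqs`, `qsForm` (the quasi-split model `U(Φ₃)(L⁺_v)`)
import Summits.HodgeConjecture.HodgeConjecture.Theorems.F0P3cStCharTSParField         -- ★ (LH6-p03 g4) «PAR-FIELD★»: `isCompact_center_Gqs` (the centre of `U(Φ₃)(L⁺_v)` is compact at a non-split `v`; over ★ `forall_mem_center_cmLocal_eq_scalar` + ★ `local_nonsplit_compactOpen_center_of_center_le`)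
import Literature.NumberTheory.Rogawski1990.LocalTransferGlueCM                       -- ★ instances `locallyCompactSpace_cmDatum_local`, `t2Space_cmDatum_local` (via `LocalUnitaryGroupCongrMeasure`)
import Mathlib.MeasureTheory.Group.Measure
import HarnessLib

/-!
# F0 · P3c · line LH6 «StCharTS» — brick «GQS-NONCOMPACT★» (datum road S4a, input of «DET-FIELD★»): `U(Φ₃)(L⁺_v)` IS NOT COMPACT, its quotient by the centre is not
# compact at a non-split place, and a Haar measure on `U(Φ₃)(L⁺_v) ⧸ Z` has INFINITE total mass

Cell `hodgecm-mathlib`, crux `H413` (`stmt-HodgeConjecture-24833`), line LH6 `Cruxes/H413/Lines/F0_P3c_StCharTSPaydown.lean`, organ (S-𝔇) `stub_EllipticPackage`.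
Seat LH6-p04 (g5), slice S4a «DET-FIELD» of the datum-road map of LH6-p01 (g4) (11:09:22Z ∕ 11:15:51Z) — this file is its measure-theoretic input: the socket (DET)
★ `EllipticData.DetNotL2` («`ψ ∘ det_G` is not square-integrable modulo the centre») is, for a unitary one-dimensional class, EXACTLY «`μZ(G ⧸ Z) = ∞`» (sequel file
«DET-FIELD★» `F0P3cStCharTSDetField`).  THEOREMS ONLY (no `def`, no named fact, no `instance`, no notation, no `sorry`; axioms ⊆ {propext, Classical.choice, Quot.sound});
`--supports stmt-HodgeConjecture-24833 --as helper`.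
HONEST LABEL: HC_CM is proved only modulo the 7 printed citations (2 remaining: hLiu418 = stmt-HodgeConjecture-24832, h413 = stmt-HodgeConjecture-24833) until rung 0
closes; this file is count-neutral (structure of the local group; nothing of (N-1273S) is proved here).

THE MATHEMATICS.
* §0 (generic) **a locally compact group `G` with a COMPACT normal subgroup `N` and COMPACT quotient `G ⧸ N` is compact**: finitely many translates `x·int(K)` of a
  compact neighbourhood `K` of `1` cover `G ⧸ N` (the quotient map is open), hence `G = ⋃ x·K·N`, a finite union of compact sets. [folklore]
* §1 **`U(Φ₃)(F_v)` is not compact for ANY finite place `v`** of the totally real field `F` (`E/F` CM∕quadratic, `Φ₃` the antidiagonal unit form): with a trace-zero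
  `δ ≠ 0` of `E`, the corner unipotents `u(b) = 1 + bE₀₂`, `b̄ = −b` — e.g. `b = ι_v(a)δ`, `a ∈ F_v` — lie in `U(Φ₃)(F_v)` (`ᵗ(σu)Φ₃u = Φ₃`, [Rogawski1990, §1.10 p. 9: the
  unipotent radical of the Borel subgroup; §3.8 p. 30: the quasi-split groups]) and the continuous `F_v`-linear functional `g ↦ Tr_{E_v∕F_v}(δ⁻¹ g₀₂)` takes the value
  `2a` on `u(ι_v(a)δ)`; a compact `U(Φ₃)(F_v)` would map continuously ONTO `F_v`, which is not compact [WeilBNT1967, Ch. I §2] — the device of ★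
  `not_compactSpace_local_antidiagTwo` one row further from the diagonal (the non-compactness of a non-archimedean local field is re-proved privately, as there).
* §2 **the quasi-split model `Gqs L v = U(Φ₃)(L⁺_v)` at a NON-SPLIT `v`**: not compact (§1, `δ = x − x̄` for any `x` moved by complex conjugation); its centre is compact
  (it consists of the unit scalars `ζ·1`, `ζζ̄ = 1` [Rogawski1990, §4.9 p. 54; Mok2014, §1 p. 5]: ★ «PAR-FIELD★» `F0P3cStCharTSParField.isCompact_center_Gqs`, over ★
  `forall_mem_center_cmLocal_eq_scalar` + ★ `local_nonsplit_compactOpen_center_of_center_le`); hence `G ⧸ Z` is NOT compact (§0), and every Haar measure on `G ⧸ Z` has infinite total mass (Mathlib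
  `measure_univ_of_isMulLeftInvariant`): `noncompactSpace_gqs_quotient_center`, `measure_univ_gqs_quotient_center`.

## References
* [Rogawski1990] J. D. Rogawski, *Automorphic Representations of Unitary Groups in Three Variables*, Ann. of Math. Stud. 123 (1990): §1.10 p. 9, §3.8 p. 30, §4.9 p. 54.
* [Mok2014] C. P. Mok, *Endoscopic classification of representations of quasi-split unitary groups*, Mem. AMS 235 (2015), §1 Notation p. 5 (the centre of `U(N)` is `U(1)`).
* [WeilBNT1967] A. Weil, *Basic Number Theory* (1967), Ch. I §2 (a non-discrete locally compact field is not compact).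
-/

set_option autoImplicit false
-- the mandated namespace has the single-problem summit's repeated segment (`HodgeConjecture.HodgeConjecture`)
set_option linter.dupNamespace false

noncomputable section

open MeasureTheory Topology Filter
open scoped ENNReal Matrix MatrixGroups
open NumberField IsDedekindDomain
open Literature.NumberTheory Literature.NumberTheory.Automorphic Literature.NumberTheory.Automorphic.UnitaryGroup
open Literature.NumberTheory.Rogawski1990

namespace Summit.HodgeConjecture.HodgeConjecture.Cruxes.H413.F0P3cStCharTSGqsNoncompact

/-! ## §0 Generic: a locally compact group with a compact normal subgroup and compact quotient is compact -/

section Generic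

/-- **A locally compact group with a compact normal subgroup `N` and compact quotient `G ⧸ N` is compact**: finitely many translates `x·int(K)` of a compact
neighbourhood `K` of `1` cover `G ⧸ N` (the quotient map is open), hence `G = ⋃ x·K·N`, a finite union of compact sets. [folklore] [cite: WeilBNT1967, Ch. I §2] -/
theorem compactSpace_of_isCompact_of_compactSpace_quotient {G : Type*} [Group G] [TopologicalSpace G] [IsTopologicalGroup G]
    [LocallyCompactSpace G] (N : Subgroup G) [N.Normal] (hN : IsCompact (N : Set G)) (hq : CompactSpace (G ⧸ N)) :
    CompactSpace G := by
  classical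
  obtain ⟨K, hK, hK1⟩ := exists_compact_mem_nhds (1 : G)
  -- open cover of the quotient by the images of the translates `x • interior K`
  let U : G → Set (G ⧸ N) := fun x => ((↑) : G → G ⧸ N) '' ((fun k => x * k) '' interior K)
  have hUo : ∀ x, IsOpen (U x) := fun x =>
    QuotientGroup.isOpenMap_coe _ ((isOpenMap_mul_left x) _ isOpen_interior)
  have hcov : (Set.univ : Set (G ⧸ N)) ⊆ ⋃ x, U x := by
    rintro q -
    obtain ⟨g, rfl⟩ := QuotientGroup.mk_surjective q
    refine Set.mem_iUnion.2 ⟨g, ⟨g * 1, ⟨1, mem_interior_iff_mem_nhds.2 hK1, rfl⟩, by rw [mul_one]⟩⟩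
  obtain ⟨T, hT⟩ := isCompact_univ.elim_finite_subcover U hUo hcov
  -- `G = ⋃_{x ∈ T} x K N`, a finite union of compact sets
  have hbig : (Set.univ : Set G) ⊆ ⋃ x ∈ T, (fun p : G × G => x * p.1 * p.2) '' (K ×ˢ (N : Set G)) := by
    intro g _
    have hq := hT (Set.mem_univ (g : G ⧸ N))
    simp only [Set.mem_iUnion] at hq
    obtain ⟨x, hxT, hx⟩ := hq
    obtain ⟨y, ⟨k, hk, rfl⟩, hy⟩ := hx
    have hn : (x * k)⁻¹ * g ∈ N := by
      rw [← QuotientGroup.eq]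
      exact hy
    refine Set.mem_iUnion₂.2 ⟨x, hxT, ⟨(k, (x * k)⁻¹ * g), ⟨interior_subset hk, hn⟩, ?_⟩⟩
    show x * k * ((x * k)⁻¹ * g) = g
    rw [mul_inv_cancel_left]
  have hcpt : IsCompact (⋃ x ∈ T, (fun p : G × G => x * p.1 * p.2) '' (K ×ˢ (N : Set G))) :=
    T.isCompact_biUnion fun x _ => (hK.prod hN).image (by fun_prop)
  exact isCompact_univ_iff.1 (hcpt.of_isClosed_subset isClosed_univ hbig)

end Generic

/-! ## §1 `U(Φ₃)(F_v)` is not compact (any finite place; the corner unipotents and the trace functional) -/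

section LocalField

open Set ValuativeRel

variable {K : Type*} [Field K] [ValuativeRel K] [TopologicalSpace K] [IsNonarchimedeanLocalField K]

/-- A non-archimedean local field is not compact: the balls `{v < t^k}` (`t > 1`) form an increasing open cover with no finite subcover, the valuation being surjective
onto the value group (local copy of ★ `LocalUnitaryGroupNoncompactRankTwo`'s private lemma, kept private here too). [folklore] [cite: WeilBNT1967, Ch. I §2] -/
private theorem not_compactSpace_of_isNonarchimedeanLocalField'' : ¬ CompactSpace K := by
  intro hF
  obtain ⟨γ, hγ0, hγ1⟩ := ValuativeRel.IsNontrivial.exists_lt_one (R := K)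
  have ht : 1 < γ⁻¹ := (one_lt_inv₀ hγ0).2 hγ1
  have ht0 : γ⁻¹ ≠ 0 := inv_ne_zero hγ0.ne'
  set U : ℕ → Set K := fun k => {x | valuation K x < γ⁻¹ ^ k} with hU
  have hUo : ∀ k, IsOpen (U k) := fun k => by
    rw [isOpen_iff_mem_nhds]
    intro x hx
    rw [IsValuativeTopology.mem_nhds_iff']
    refine ⟨Units.mk0 (γ⁻¹ ^ k) (pow_ne_zero _ ht0), fun z hz => ?_⟩
    have hz' : valuation K (z - x) < γ⁻¹ ^ k := by simpa using hz
    have hx' : valuation K x < γ⁻¹ ^ k := hx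
    show valuation K z < γ⁻¹ ^ k
    calc valuation K z = valuation K (z - x + x) := by rw [sub_add_cancel]
      _ ≤ max (valuation K (z - x)) (valuation K x) := Valuation.map_add _ _ _
      _ < γ⁻¹ ^ k := max_lt hz' hx'
  have hcov : (univ : Set K) ⊆ ⋃ k, U k := fun x _ => by
    obtain ⟨k, hk⟩ := MulArchimedean.arch (valuation K x) ht
    exact mem_iUnion.2 ⟨k + 1, lt_of_le_of_lt hk (pow_lt_pow_right₀ ht (Nat.lt_succ_self k))⟩
  obtain ⟨T, hT⟩ := (@isCompact_univ K _ hF).elim_finite_subcover U hUo hcov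
  have hmono : ∀ {k l : ℕ}, k ≤ l → U k ⊆ U l := fun hkl x hx =>
    lt_of_lt_of_le hx (pow_le_pow_right₀ ht.le hkl)
  obtain ⟨g, hg⟩ := ValuativeRel.valuation_surjective (γ⁻¹ ^ (T.sup id) : ValueGroupWithZero K)
  have hmem := hT (mem_univ g)
  simp only [mem_iUnion] at hmem
  obtain ⟨k, hk, hgk⟩ := hmem
  have hlt : valuation K g < γ⁻¹ ^ (T.sup id) := hmono (Finset.le_sup (f := id) hk) hgk
  rw [hg] at hlt
  exact lt_irrefl _ hlt

end LocalField

section Unipotent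

variable {R : Type} [CommRing R]

/-- `u(b) · u(−b) = 1` for the corner unipotent `u(b) = 1 + bE₀₂` of `GL₃`. [cite: Rogawski1990, §1.10 p. 9] -/
theorem cornerUnipotent_mul_neg (b : R) : !![(1 : R), 0, b; 0, 1, 0; 0, 0, 1] * !![1, 0, -b; 0, 1, 0; 0, 0, 1] = 1 := by
  simp only [Matrix.mul_fin_three, Matrix.one_fin_three, mul_one, mul_zero, add_zero, zero_add, one_mul, zero_mul, mul_neg,
    neg_zero, neg_add_cancel]

/-- `u(−b) · u(b) = 1`. [cite: Rogawski1990, §1.10 p. 9] -/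
theorem cornerUnipotent_neg_mul (b : R) : !![(1 : R), 0, -b; 0, 1, 0; 0, 0, 1] * !![1, 0, b; 0, 1, 0; 0, 0, 1] = 1 := by
  simp only [Matrix.mul_fin_three, Matrix.one_fin_three, mul_one, mul_zero, add_zero, zero_add, one_mul, zero_mul, add_neg_cancel]

/-- **`u(b)` is `Φ₃`-unitary when `b̄ = −b`**: `ᵗ(σ u(b)) · Φ₃ · u(b) = Φ₃` for the antidiagonal unit form `Φ₃`. [cite: Rogawski1990, §1.10 p. 9; §3.8 p. 30] -/
theorem cornerUnipotent_unitary (σ : R →+* R) (b : R) (hb : σ b = -b) :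
    ((!![(1 : R), 0, b; 0, 1, 0; 0, 0, 1]).map σ)ᵀ * !![(0 : R), 0, 1; 0, 1, 0; 1, 0, 0] * !![(1 : R), 0, b; 0, 1, 0; 0, 0, 1] =
      !![(0 : R), 0, 1; 0, 1, 0; 1, 0, 0] := by
  ext i j
  fin_cases i <;> fin_cases j <;>
    simp only [Matrix.mul_apply, Fin.sum_univ_three, Matrix.transpose_apply, Matrix.map_apply, Matrix.of_apply, Matrix.cons_val',
      Matrix.cons_val_zero, Matrix.cons_val_one, Matrix.cons_val_two, Matrix.cons_val_fin_one, Matrix.empty_val', Matrix.head_cons,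
      Matrix.tail_cons, Matrix.head_fin_const, Fin.isValue, Fin.mk_one, Fin.zero_eta, Fin.reduceFinMk, map_one, map_zero, hb,
      one_mul, mul_one, mul_zero, zero_mul, add_zero, zero_add, neg_zero, add_neg_cancel, neg_mul]

end Unipotent

section Noncompact

variable {F E : Type} [Field F] [NumberField F] [Field E] [NumberField E] [Algebra F E]
  [Algebra.IsQuadraticExtension F E] (c : E ≃ₐ[F] E)

omit [NumberField F] [Algebra.IsQuadraticExtension F E] in
/-- The local Gram matrix of the antidiagonal unit form `Φ₃` is `antidiag(1,1,1)`. [cite: Rogawski1990, §3.8 p. 30] -/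
theorem localGram_antidiagThree (v : HeightOneSpectrum (𝓞 F)) :
    (adelicForm E 3 (Matrix.of fun i j : Fin 3 => if i.val + j.val + 1 = 3 then (1 : E) else 0)).map (adeleToLocal E v) =
      !![(0 : LocalRing E v), 0, 1; 0, 1, 0; 1, 0, 0] := by
  rw [Liu2021.LemD1OfPlace.localGram_eq E v 3]
  ext i j
  simp only [Matrix.map_apply, Matrix.of_apply]
  fin_cases i <;> fin_cases j <;> simp only [Fin.isValue, Fin.mk_one, Fin.zero_eta, Fin.reduceFinMk, Nat.reduceAdd, Nat.reduceEqDiff,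
    reduceIte, map_one, map_zero, Matrix.cons_val', Matrix.cons_val_zero, Matrix.cons_val_one, Matrix.cons_val_two, Matrix.cons_val_fin_one,
    Matrix.empty_val', Matrix.head_cons, Matrix.tail_cons, Matrix.head_fin_const]

omit [Algebra.IsQuadraticExtension F E] in
/-- **The corner unipotent `u(b)`, `b̄ = −b`, lies in `U(Φ₃)(F_v)`.** [cite: Rogawski1990, §1.10 p. 9; §3.8 p. 30] -/
theorem cornerUnipotent_mem_local (v : HeightOneSpectrum (𝓞 F)) (b : LocalRing E v) (hb : conjLocal E c v b = -b) :
    (⟨!![1, 0, b; 0, 1, 0; 0, 0, 1], !![1, 0, -b; 0, 1, 0; 0, 0, 1], cornerUnipotent_mul_neg b, cornerUnipotent_neg_mul b⟩ :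
        GL (Fin 3) (LocalRing E v)) ∈
      «local» E c 3 (Matrix.of fun i j : Fin 3 => if i.val + j.val + 1 = 3 then (1 : E) else 0) v := by
  show _ ∈ unitaryGroupOfForm _ _
  rw [mem_unitaryGroupOfForm_iff, localGram_antidiagThree]
  exact cornerUnipotent_unitary (conjLocal E c v) b hb

/-- **`U(Φ₃)(F_v)` is not compact** (any finite place `v` of `F`): with a trace-zero `δ ≠ 0` of `E`, the unipotents `u(ι_v(a)δ)`, `a ∈ F_v`, lie in `U(Φ₃)(F_v)` and the
continuous `F_v`-linear functional `g ↦ Tr_{E_v∕F_v}(δ⁻¹ g₀₂)` takes the value `2a` on them; a compact `U(Φ₃)(F_v)` would map continuously ONTO the non-compact `F_v`.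
(The device of ★ `not_compactSpace_local_antidiagTwo`, [Rogawski1990, §3.8 p. 30].) [cite: Rogawski1990, §3.8 p. 30] [cite: WeilBNT1967, Ch. I §2] -/
theorem not_compactSpace_local_antidiagThree {δ : E} (hcδ : c δ = -δ) (hδ : δ ≠ 0) (v : HeightOneSpectrum (𝓞 F)) :
    ¬ CompactSpace («local» E c 3 (Matrix.of fun i j : Fin 3 => if i.val + j.val + 1 = 3 then (1 : E) else 0) v) := by
  classical
  intro hK
  haveI : CharZero (v.adicCompletion F) := charZero_of_injective_algebraMap (algebraMap F _).injective
  haveI : IsModuleTopology (v.adicCompletion F) (LocalRing E v) := Liu2021.LemD1OfPlace.isModuleTopology_localRing E v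
  set Φ : Matrix (Fin 3) (Fin 3) E := Matrix.of fun i j : Fin 3 => if i.val + j.val + 1 = 3 then (1 : E) else 0 with hΦ
  -- the continuous functional `g ↦ Tr(δ⁻¹ · g₀₂)`
  let δv : LocalRing E v := algebraMap E (LocalRing E v) δ
  let ℓ : LocalRing E v →ₗ[v.adicCompletion F] v.adicCompletion F :=
    (Algebra.trace (v.adicCompletion F) (LocalRing E v)) ∘ₗ
      (LinearMap.mulLeft (v.adicCompletion F) (algebraMap E (LocalRing E v) δ⁻¹))
  have hℓ : Continuous ℓ := IsModuleTopology.continuous_of_linearMap ℓ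
  let e : («local» E c 3 Φ v) → v.adicCompletion F := fun g =>
    ℓ ((((g : GL (Fin 3) (LocalRing E v)) : Matrix (Fin 3) (Fin 3) (LocalRing E v))) 0 2)
  have he : Continuous e := by
    refine hℓ.comp ?_
    exact (Units.continuous_val.comp continuous_subtype_val).matrix_elem 0 2
  -- `e (u(ι a δ)) = 2 a`
  have hval : ∀ a : v.adicCompletion F, ∃ g : «local» E c 3 Φ v, e g = (2 : ℕ) • a := by
    intro a
    have hb : conjLocal E c v (algebraMap (v.adicCompletion F) (LocalRing E v) a * δv) =
        -(algebraMap (v.adicCompletion F) (LocalRing E v) a * δv) := by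
      rw [map_mul, algebraMap_localRing_eq, conjLocal_toLocalRing, conjLocal_algebraMap, hcδ, map_neg, mul_neg]
    refine ⟨⟨_, cornerUnipotent_mem_local c v _ hb⟩, ?_⟩
    show ℓ (algebraMap (v.adicCompletion F) (LocalRing E v) a * δv) = (2 : ℕ) • a
    have hδδ : algebraMap E (LocalRing E v) δ⁻¹ * (algebraMap (v.adicCompletion F) (LocalRing E v) a * δv) =
        algebraMap (v.adicCompletion F) (LocalRing E v) a := by
      rw [mul_left_comm, ← map_mul, inv_mul_cancel₀ hδ, map_one, mul_one]
    simp only [ℓ, LinearMap.coe_comp, Function.comp_apply, LinearMap.mulLeft_apply, hδδ]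
    rw [Algebra.trace_algebraMap, finrank_localRing E v]
  -- a compact `U(Φ₃)(F_v)` would surject continuously onto `F_v`
  have hsurj : Function.Surjective e := by
    intro t
    obtain ⟨g, hg⟩ := hval (t / 2)
    refine ⟨g, ?_⟩
    rw [hg, nsmul_eq_mul, Nat.cast_ofNat, mul_div_cancel₀ t (two_ne_zero)]
  have hKF : CompactSpace (v.adicCompletion F) := ⟨by rw [← hsurj.range_eq]; exact isCompact_range he⟩
  exact not_compactSpace_of_isNonarchimedeanLocalField'' (K := v.adicCompletion F) hKF

end Noncompact

/-! ## §2 The quasi-split model `U(Φ₃)(L⁺_v)` at a NON-SPLIT place: `G` not compact, `Z(G)` compact, `G ⧸ Z` not compact, Haar mass of `G ⧸ Z` infinite -/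

section Model

variable (L : Type) [Field L] [NumberField L] [IsCMField L]

/-- **`U(Φ₃)(L⁺_v)` is not compact** (every finite place `v` of `L⁺`; a trace-zero `δ = x − x̄ ≠ 0` exists since complex conjugation of the CM field `L` is not the
identity). [cite: Rogawski1990, §3.8 p. 30] -/
theorem not_compactSpace_gqs (v : HeightOneSpectrum (𝓞 ↥(maximalRealSubfield L))) : ¬ CompactSpace (Gqs L v) := by
  obtain ⟨x, hx⟩ : ∃ x : L, IsCMField.complexConj L x ≠ x := by
    by_contra h
    push Not at h
    exact IsCMField.complexConj_ne_one L (AlgEquiv.ext h)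
  have hcδ : IsCMField.complexConj L (x - IsCMField.complexConj L x) = -(x - IsCMField.complexConj L x) := by
    rw [map_sub, IsCMField.complexConj_apply_apply, neg_sub]
  have hδ : x - IsCMField.complexConj L x ≠ 0 := fun h => hx (sub_eq_zero.1 h).symm
  exact not_compactSpace_local_antidiagThree (IsCMField.complexConj L) hcδ hδ v

/-- **`U(Φ₃)(L⁺_v) ⧸ Z` is not compact at a non-split `v`** (§0 compact-by-compact: `Z` compact — ★ `F0P3cStCharTSParField.isCompact_center_Gqs` —, `G` not compact). [cite: Rogawski1990, §3.8 p. 30; §4.9 p. 54] -/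
theorem noncompactSpace_gqs_quotient_center (v : HeightOneSpectrum (𝓞 ↥(maximalRealSubfield L)))
    (hns : ∀ w : PlacesOver L v, IsCMField.complexConj L • w.1 = w.1) :
    NoncompactSpace (Gqs L v ⧸ Subgroup.center (Gqs L v)) := by
  rw [← not_compactSpace_iff]
  intro hq
  exact not_compactSpace_gqs L v
    (compactSpace_of_isCompact_of_compactSpace_quotient (Subgroup.center (Gqs L v))
      (F0P3cStCharTSParField.isCompact_center_Gqs L v hns) hq)

/-- **A Haar measure on `U(Φ₃)(L⁺_v) ⧸ Z` has infinite total mass** at a non-split `v` (Mathlib `measure_univ_of_isMulLeftInvariant` on the non-compact locally compact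
quotient). [cite: Rogawski1990, §1.6 p. 5; §4.9 p. 54] -/
theorem measure_univ_gqs_quotient_center (v : HeightOneSpectrum (𝓞 ↥(maximalRealSubfield L)))
    (hns : ∀ w : PlacesOver L v, IsCMField.complexConj L • w.1 = w.1)
    [MeasurableSpace (Gqs L v ⧸ Subgroup.center (Gqs L v))] [BorelSpace (Gqs L v ⧸ Subgroup.center (Gqs L v))]
    (μZ : Measure (Gqs L v ⧸ Subgroup.center (Gqs L v))) [μZ.IsHaarMeasure] : μZ Set.univ = ∞ := by
  haveI := noncompactSpace_gqs_quotient_center L v hns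
  exact measure_univ_of_isMulLeftInvariant μZ

end Model

end Summit.HodgeConjecture.HodgeConjecture.Cruxes.H413.F0P3cStCharTSGqsNoncompact

end
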